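import Literature.Computability.Cryptography.ChenQuantumLWESecretIndependence

/-!
# Chen 2024 (withdrawn), Step 8 performed honestly: the law of `|φ7.d⟩`, Claim 3.14, and the Step-8 ceiling

REPRODUCTION / TYPED SKELETON OF A CLAIMED RESULT UNDER ADJUDICATION — header required by the tree's
literature rule.  Author: Yilei Chen.  Title: *Quantum Algorithms for Lattice Problems*.  Venue: IACR
Cryptology ePrint Archive, Paper 2024/555, version of 18 April 2024 (the main claim WITHDRAWN by the author,
title-page note; the bug is in Step 9, p. 37). [ChenQuantumLattice2024]  Printed page numbers.

HONEST FRAMING (bundle `papers/QuantumAdvantage/lwe-quantum-autopsy/`, Part 1): the value of this file is a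
THEOREM / DECIDABLE VERDICT about a withdrawn algorithm — a precise negative result and a positive
certificate of one of its steps — NOT summit progress, no cryptanalytic claim in either direction.

WHAT IS DONE HERE.  `ChenQuantumLWESteps.lean` types Step 8 (§3.5.8, Lemma 3.13 / Claim 3.14, pp. 32–34)
only as the CLAIM `Shape.Claim314 ψ` about an unspecified state `ψ = |φ7.d⟩`.  This file PERFORMS Step 8 on
the registers, exactly as printed, starting from the Steps module's `|φ7⟩` (`Shape.phi7`, eq. (35)):
(8.i) the domain extension `ℤ_M → ℤ_{DM}` of Lemma 2.17 (`domainExt D`, the register operation, defined for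
every input); (8.ii) "divide the whole register by `D`" (relabel `|D·y⟩ ↦ |y⟩`, `y ∈ ℤ_Mⁿ⁺¹`); (8.iii) the
phase kickback `e(+y₀²/(2M))` on the first coordinate (p. 33; well defined on `ℤ_M` because `M` is even,
p. 33 remark); (8.iv) `QFT_{ℤ_Mⁿ⁺¹}` (sign `−`).  The result `Shape.phi7d` is `|φ7.d⟩`.  We prove:

* `Shape.phi7d_ne_zero_iff` — the EXACT support of `|φ7.d⟩`: `w` has non-zero amplitude iff
  `D ∣ w_i (i ≠ 0)` and `DP = M/(2D) ∣ ⟨b, w⟩ + v′₀/D`; and `Shape.norm_sq_phi7d_of_pred8` — the amplitude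
  has the same modulus `(D^{n+1}P)²·2ⁿ` on the whole support (the law is uniform on it).
* `Shape.claim314_phi7d` — **Claim 3.14 is CORRECT** for the state the operations produce
  (`S.Claim314 S.phi7d` for every admissible shape): a kernel-checked confirmation of the author's
  18-April note on p. 32 ("the domain extension trick applied here is correct") — Step 8, unlike Step 9, is
  sound; consequently the fifth operation (p. 34) reads
  `w₀ mod Dp₁ = v′₀/D mod Dp₁`, i.e. `v′₀ mod D²p₁` (`Shape.step8Output`), with certainty and without
  disturbing `|φ7⟩`.
* `Shape.step8_ceiling_iff` — **the Step-8 ceiling** (this bundle's diagnosis, `STEPS.md` §4.3 /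
  `REPAIR-CENSUS.md` T7): for `g ∣ P`, the outcome determines `w₀ ≡ v′₀/D (mod D·g)` with certainty
  IF AND ONLY IF `g ∣ b_i` for all `i ≠ 0`.  With eq. (12) (`b ∈ −1 | 2p₁ℤⁿ`, nothing more) the modulus
  `Dp₁` of Claim 3.14 is therefore the LARGEST Step 8 can certify: the missing factor to what Step 9
  consumes (`Shape.step9Needs = v′₀ mod D²P`, `STEPS.md` §4.3) is exactly `Q = p₂⋯p_κ ≥ 3`.
* `Shape.step8_information_ceiling` / `Shape.step8_cannot_supply_step9Needs` — the same ceiling for every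
  read-out OF THE OUTCOME: any statistic `F(w)` of the computational-basis outcome `w` of `|φ7.d⟩` that is
  non-demolition (almost surely constant, as Lemma 3.13 requires in order to keep `|φ8⟩ = |φ7⟩`) on every
  admissible instance with the public parameters `n, D, p₁, Q` takes a value that depends on the unknown
  `v′₀` only through `v′₀ mod D²p₁`; in particular it cannot distinguish two admissible instances with the
  same `step8Output` and different `step9Needs`.  SCOPE: functions of `w` (Chen's fifth operation computes
  and measures one, `w₀ mod Dp₁`); general instruments / POVMs not diagonal in the `w` basis are NOT modelled
  here (the same scope as Part 2's `ChenQuantumLWENonDisturbing.lean` for Step 9).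

Method: characters of `ℤ_M`, `ℤ_D`, `ℤ_P` (`ZMod.stdAddChar`, orthogonality `AddChar.sum_mulShift`); the
fibre of "extend then divide" over a point `D·c` of `|φ7⟩` is `{c + (M/D)h : h ∈ ℤ_D}` per coordinate
(`sum_fibre_D_mul`); the kick turns the `h`-sum on coordinate `0` into the indicator `[w₀ ≡ v′₀/D (mod D)]`,
the plain `h`-sums on the other coordinates into `[D ∣ w_i]`, the `j`-sum into `[DP ∣ ⟨b,w⟩ + v′₀/D]`, and the
`k`-sum into a product of factors `1 ± i` of modulus `√2`.  Everything is `sorry`-free over Mathlib.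
-/

namespace Literature.Computability.Cryptography.Chen2024

open scoped BigOperators

/-! ### Generic helpers: the phase `e`, character sums, the extend-and-divide fibre -/

/-- `e(z) = 1` for an integer `z`. [folklore] -/
theorem e_intCast (z : ℤ) : e (z : ℚ) = 1 := by
  unfold e
  have h : (2 * Real.pi * Complex.I * ((z : ℚ) : ℂ)) = (z : ℂ) * (2 * Real.pi * Complex.I) := by
    push_cast
    ring
  rw [h]
  exact Complex.exp_int_mul_two_pi_mul_I z

/-- `e(q) = e(q')` when `q - q'` is an integer. [folklore] -/
theorem e_eq_e_of_sub_eq_intCast {q q' : ℚ} (z : ℤ) (h : q - q' = z) : e q = e q' := by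
  rw [show q = q' + (z : ℚ) by rw [← h]; ring, e_add, e_intCast, mul_one]

/-- `e` of a finite sum is the product. [folklore] -/
theorem e_sum {ι : Type*} (s : Finset ι) (f : ι → ℚ) : e (∑ i ∈ s, f i) = ∏ i ∈ s, e (f i) := by
  classical
  induction s using Finset.induction_on with
  | empty => simpa using e_intCast 0
  | insert a s ha ih => rw [Finset.sum_insert ha, Finset.prod_insert ha, e_add, ih]

/-- The standard additive character of a finite sum is the product. [folklore] -/
theorem stdAddChar_sum_eq_prod {ι : Type*} (s : Finset ι) {m : ℕ} [NeZero m] (f : ι → ZMod m) :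
    ZMod.stdAddChar (∑ i ∈ s, f i) = ∏ i ∈ s, ZMod.stdAddChar (f i) := by
  classical
  induction s using Finset.induction_on with
  | empty => simp
  | insert a s ha ih => rw [Finset.sum_insert ha, Finset.prod_insert ha, AddChar.map_add_eq_mul, ih]

/-- **Orthogonality over one period:** `Σ_{h<D} e(h·a/D) = D·[D ∣ a]`. [folklore] -/
theorem sum_range_e_mul_div (D : ℕ) [NeZero D] (a : ℤ) :
    ∑ hh ∈ Finset.range D, e ((((hh : ℤ) * a : ℤ) : ℚ) / D)
      = if ((a : ℤ) : ZMod D) = 0 then ((D : ℕ) : ℂ) else 0 := by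
  have h1 : ∀ hh : ℕ, e ((((hh : ℤ) * a : ℤ) : ℚ) / D)
      = ZMod.stdAddChar (((hh : ℕ) : ZMod D) * ((a : ℤ) : ZMod D)) := by
    intro hh
    rw [e_intCast_div_eq_stdAddChar]
    push_cast
    rfl
  simp_rw [h1]
  rw [sum_range_eq_sum_zmod D (fun x => ZMod.stdAddChar (x * ((a : ℤ) : ZMod D))),
    AddChar.sum_mulShift _ (ZMod.isPrimitive_stdAddChar D), ZMod.card, Nat.cast_ite, Nat.cast_zero]

/-- **The fibre of "extend by `D`, then divide by `D`".**  For `M = D·L`, the solutions `y ∈ ℤ_M` of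
`D·y = D·c` are exactly the `D` distinct points `c + L·h`, `h < D`; as a sum identity against any weight.
(Lemma 2.17 adjoins a uniform digit; the division relabels.) [cite: ChenQuantumLattice2024, Lemma 2.17 p. 14;
§3.5.8 p. 33] -/
theorem sum_fibre_D_mul (M D L : ℕ) [NeZero M] (hM : (M : ℤ) = D * L) (c : ℤ) (G : ZMod M → ℂ) :
    ∑ y : ZMod M, (if ((D : ℕ) : ZMod M) * y = (((D : ℤ) * c : ℤ) : ZMod M) then G y else 0)
      = ∑ hh ∈ Finset.range D, G (((c + L * hh : ℤ)) : ZMod M) := by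
  have hD0 : (D : ℤ) ≠ 0 := by
    rintro hD
    rw [hD, zero_mul] at hM
    exact NeZero.ne M (by exact_mod_cast hM)
  have hL0 : (L : ℤ) ≠ 0 := by
    rintro hL
    rw [hL, mul_zero] at hM
    exact NeZero.ne M (by exact_mod_cast hM)
  haveI : NeZero D := ⟨by exact_mod_cast hD0⟩
  -- (i) the points `c + L·h` lie in the fibre
  have hsol : ∀ hh : ℕ, ((D : ℕ) : ZMod M) * (((c + L * hh : ℤ)) : ZMod M)
      = (((D : ℤ) * c : ℤ) : ZMod M) := by
    intro hh
    have key := intCast_eq_of_sub_eq_mul (N := M) ((D : ℤ) * (c + L * hh)) ((D : ℤ) * c) (-(hh : ℤ))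
      (by rw [hM]; ring)
    rw [← key]
    push_cast
    ring
  -- (ii) every solution is one of them
  have hex : ∀ y : ZMod M, ((D : ℕ) : ZMod M) * y = (((D : ℤ) * c : ℤ) : ZMod M) →
      ∃ hh ∈ Finset.range D, y = (((c + L * hh : ℤ)) : ZMod M) := by
    intro y hy
    have hy' : ((((D : ℤ) * (y.val : ℕ) : ℤ)) : ZMod M) = (((D : ℤ) * c : ℤ) : ZMod M) := by
      rw [← hy]
      push_cast
      rw [ZMod.natCast_zmod_val]
    obtain ⟨t, ht⟩ := (ZMod.intCast_eq_intCast_iff_dvd_sub _ _ _).1 hy'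
    rw [hM] at ht
    have ht' : ((y.val : ℕ) : ℤ) = c - L * t := by
      apply mul_left_cancel₀ hD0
      linear_combination (-1 : ℤ) * ht
    obtain ⟨hh, hlt, hmod⟩ : ∃ hh : ℕ, hh < D ∧ ((hh : ℤ) : ZMod D) = ((-t : ℤ) : ZMod D) :=
      ⟨((-t : ℤ) : ZMod D).val, ZMod.val_lt _, by rw [Int.cast_natCast, ZMod.natCast_zmod_val]⟩
    refine ⟨hh, Finset.mem_range.2 hlt, ?_⟩
    obtain ⟨d, hd⟩ : (D : ℤ) ∣ (hh : ℤ) + t := by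
      have h2 := (ZMod.intCast_eq_intCast_iff_dvd_sub _ _ _).1 hmod
      have h3 : (hh : ℤ) + t = -((-t) - hh) := by ring
      rw [h3, dvd_neg]
      exact h2
    rw [← ZMod.natCast_zmod_val y]
    have key := intCast_eq_of_sub_eq_mul (N := M) ((y.val : ℕ) : ℤ) (c + L * hh) d
      (by rw [hM]; linear_combination (-1 : ℤ) * ht' + (L : ℤ) * hd)
    simpa only [Int.cast_natCast] using key
  -- (iii) they are distinct
  have hinj : ∀ {h₁ h₂ : ℕ}, h₁ < D → h₂ < D →
      (((c + L * h₁ : ℤ)) : ZMod M) = (((c + L * h₂ : ℤ)) : ZMod M) → h₁ = h₂ := by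
    intro h₁ h₂ hh₁ hh₂ heq
    obtain ⟨t, ht⟩ := (ZMod.intCast_eq_intCast_iff_dvd_sub _ _ _).1 heq
    rw [hM] at ht
    have ht' : ((h₂ : ℤ) - h₁) = D * t := by
      apply mul_left_cancel₀ hL0
      linear_combination ht
    have hmod : ((h₁ : ℤ) : ZMod D) = ((h₂ : ℤ) : ZMod D) :=
      (ZMod.intCast_eq_intCast_iff_dvd_sub _ _ _).2 ⟨t, ht'⟩
    push_cast at hmod
    exact Nat.ModEq.eq_of_lt_of_lt ((ZMod.natCast_eq_natCast_iff _ _ _).1 hmod) hh₁ hh₂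
  -- the indicator of the fibre, pointwise
  have hind : ∀ y : ZMod M,
      (if ((D : ℕ) : ZMod M) * y = (((D : ℤ) * c : ℤ) : ZMod M) then G y else 0)
        = ∑ hh ∈ Finset.range D, if y = (((c + L * hh : ℤ)) : ZMod M) then G y else 0 := by
    intro y
    by_cases hy : ((D : ℕ) : ZMod M) * y = (((D : ℤ) * c : ℤ) : ZMod M)
    · rw [if_pos hy]
      obtain ⟨h₀, hh₀, rfl⟩ := hex y hy
      rw [Finset.sum_eq_single_of_mem h₀ hh₀ fun hh hhh hne => ?_, if_pos rfl]
      exact if_neg fun heq => hne (hinj (Finset.mem_range.1 hhh) (Finset.mem_range.1 hh₀) heq.symm)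
    · rw [if_neg hy]
      symm
      refine Finset.sum_eq_zero fun hh _ => if_neg fun heq => hy ?_
      rw [heq]
      exact hsol hh
  simp_rw [hind]
  rw [Finset.sum_comm]
  refine Finset.sum_congr rfl fun hh _ => ?_
  rw [Finset.sum_ite_eq' Finset.univ ((((c + L * hh : ℤ)) : ZMod M)) G, if_pos (Finset.mem_univ _)]

/-- `e(1/4) = i`. [folklore] -/
theorem e_one_div_four : e (1 / 4 : ℚ) = Complex.I := by
  unfold e
  have h : (2 * Real.pi * Complex.I * ((1 / 4 : ℚ) : ℂ)) = ((Real.pi / 2 : ℝ) : ℂ) * Complex.I := by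
    push_cast
    ring
  rw [h, Complex.exp_mul_I, ← Complex.ofReal_cos, ← Complex.ofReal_sin, Real.cos_pi_div_two,
    Real.sin_pi_div_two]
  simp

/-- `‖1 + e(1/4 - m/2)‖² = 2` for every integer `m` (`e(1/4 - m/2) = ± i`). [folklore] -/
theorem norm_sq_one_add_e (m : ℤ) : ‖1 + e (1 / 4 - (m : ℚ) / 2)‖ ^ 2 = 2 := by
  rcases Int.even_or_odd m with ⟨r, hr⟩ | ⟨r, hr⟩
  · have h1 : e (1 / 4 - (m : ℚ) / 2) = e (1 / 4) :=
      e_eq_e_of_sub_eq_intCast (-r) (by rw [hr]; push_cast; ring)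
    rw [h1, e_one_div_four, Complex.sq_norm, Complex.normSq_apply]
    simp
    norm_num
  · have h1 : e (1 / 4 - (m : ℚ) / 2) = e (1 / 4) * e (1 / 2) :=
      by rw [← e_add]; exact e_eq_e_of_sub_eq_intCast (-r - 1) (by rw [hr]; push_cast; ring)
    have h2 : e (1 / 2 : ℚ) = -1 := by
      have h3 : e (1 / 2 : ℚ) = e (1 / 4) * e (1 / 4) := by rw [← e_add]; norm_num
      rw [h3, e_one_div_four, Complex.I_mul_I]
    rw [h1, h2, e_one_div_four, Complex.sq_norm, Complex.normSq_apply]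
    simp
    norm_num

namespace Shape

variable (S : Shape)

/-! ### Arithmetic of the moduli -/

/-- `M = 2D²P` over `ℤ`. [cite: ChenQuantumLattice2024, Cond. C.3 p. 18] -/
theorem M_coe : ((S.M : ℕ) : ℤ) = 2 * (S.D : ℤ) * S.D * S.P := by
  show ((((2 * (S.D * S.D * S.P) : ℕ+)) : ℕ) : ℤ) = _
  push_cast
  ring

/-- `M = 2D²P` over `ℚ`. [cite: ChenQuantumLattice2024, Cond. C.3 p. 18] -/
theorem M_coe_rat : ((S.M : ℕ) : ℚ) = 2 * (S.D : ℚ) * S.D * S.P := by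
  exact_mod_cast S.M_coe

/-- `M = 2D·(DP)` over `ℕ`. [cite: ChenQuantumLattice2024, Cond. C.3 p. 18] -/
theorem M_nat : (S.M : ℕ) = 2 * S.D * (S.D * S.P) := by
  show ((2 * (S.D * S.D * S.P) : ℕ+) : ℕ) = _
  push_cast
  ring

/-- `M/(2D) = D·P` (the modulus of the first congruence of Claim 3.14). [cite: ChenQuantumLattice2024, Cond. C.3 p. 18] -/
theorem M_div_two_D : (S.M : ℕ) / (2 * S.D) = S.D * S.P := by
  rw [S.M_nat, Nat.mul_div_cancel_left _ (by positivity)]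

/-- `D < M`. [cite: ChenQuantumLattice2024, Cond. C.3 p. 18] -/
theorem D_lt_M : (S.D : ℕ) < S.M := by
  rw [show (S.M : ℕ) = 2 * (S.D * (S.D * S.P)) by rw [S.M_nat]; ring]
  have h1 : (1 : ℕ) ≤ S.D * S.P := Nat.one_le_iff_ne_zero.2 (Nat.mul_ne_zero S.D.ne_zero S.P.ne_zero)
  have h2 : (S.D : ℕ) ≤ S.D * (S.D * S.P) := Nat.le_mul_of_pos_right _ h1
  have h3 : 0 < (S.D : ℕ) := S.D.pos
  omega

/-! ### Step 8, operations (8.i)–(8.iv), on the registers (pp. 32–33) -/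

/-- (8.i) `|φ7.a⟩`: the domain extension `ℤ_M → ℤ_{DM}` of Lemma 2.17 applied to `|φ7⟩` (all coordinates).
[cite: ChenQuantumLattice2024, §3.5.8 p. 32, Lemma 2.17 p. 14] -/
noncomputable def phi7a : Ket (S.n + 1) ((S.D : ℕ) * S.M) := domainExt (S.D : ℕ) S.phi7

/-- (8.ii) "divide the whole register by `D`": on the span of the `|z⟩` with `z ∈ Dℤ` (which contains
`|φ7.a⟩`, `phi7a_apply_ne_zero`), relabel `|D·y⟩ ↦ |y⟩`, `y ∈ ℤ_Mⁿ⁺¹`; on amplitudes, the new amplitude at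
`y` is the old one at `D·y ∈ ℤ_{DM}ⁿ⁺¹`. [cite: ChenQuantumLattice2024, §3.5.8 p. 33] -/
noncomputable def divideByD (ψ : Ket (S.n + 1) ((S.D : ℕ) * S.M)) : Ket (S.n + 1) S.M :=
  fun y => ψ (fun i => ((((S.D : ℕ) * (y i).val : ℕ)) : ZMod ((S.D : ℕ) * S.M)))

/-- (8.ii) `|φ7.b⟩`. [cite: ChenQuantumLattice2024, §3.5.8 p. 33] -/
noncomputable def phi7b : Ket (S.n + 1) S.M := S.divideByD S.phi7a

/-- (8.iii) the kicked phase, in turns: `y₀²/(2M)` on the canonical representative of the first coordinate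
(p. 33: multiply `e^{2πi ((2Dj)(−1) + v′₁/D)²/(2M)}`; well defined modulo `M` since `M` is even, p. 33 remark).
[cite: ChenQuantumLattice2024, §3.5.8 p. 33, Lemma 2.13 p. 13] -/
def kick8 (y : Fin (S.n + 1) → ZMod S.M) : ℚ := (((y 0).val : ℕ) : ℚ) ^ 2 / (2 * (S.M : ℕ))

/-- (8.iii) `|φ7.c⟩`. [cite: ChenQuantumLattice2024, §3.5.8 p. 33] -/
noncomputable def phi7c : Ket (S.n + 1) S.M := kick S.kick8 S.phi7b

/-- (8.iv) `|φ7.d⟩ = QFT_{ℤ_Mⁿ⁺¹} |φ7.c⟩` — the state measured in Step 8. [cite: ChenQuantumLattice2024, §3.5.8 p. 33] -/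
noncomputable def phi7d : Ket (S.n + 1) S.M := qft S.phi7c

/-- (8.i)+(8.ii) on amplitudes: `|φ7.b⟩(y) = |φ7⟩(D·y mod M)` — the pull-back along multiplication by `D`.
[cite: ChenQuantumLattice2024, Lemma 2.17 p. 14, §3.5.8 p. 33] -/
theorem phi7b_apply (y : Fin (S.n + 1) → ZMod S.M) :
    S.phi7b y = S.phi7 (fun i => ((S.D : ℕ) : ZMod S.M) * y i) := by
  unfold phi7b divideByD phi7a domainExt
  congr 1
  funext i
  rw [map_natCast]
  push_cast
  rw [ZMod.natCast_zmod_val]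

/-! ### The branches of `|φ7⟩` and their points after the division -/

/-- The amplitude `e(−(2Dj)²/(2M))·e(‖k‖²/4) = e(−j²/P)·e(‖k‖²/4)` of branch `(j,k)` of `|φ7⟩` (eq. (35)).
[cite: ChenQuantumLattice2024, eq. (35) p. 31] -/
noncomputable def amp7 (j : ℕ) (k : Fin S.n → Fin 2) : ℂ :=
  e (-((j : ℚ) ^ 2) / S.P) * e ((∑ t, ((k t : ℕ) : ℚ) ^ 2) / 4)

/-- `|φ7⟩` unfolded (eq. (35)). [cite: ChenQuantumLattice2024, eq. (35) p. 31] -/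
theorem phi7_apply (z : Fin (S.n + 1) → ZMod S.M) :
    S.phi7 z = ∑ j ∈ Finset.range S.P, ∑ k : Fin S.n → Fin 2,
      if z = S.pt7 j k then S.amp7 j k else 0 := rfl

/-- `ω := v′₀/D` (exact under `Admissible.v'_in_DZ`); Step 8 is after `ω mod Dp₁`.
[cite: ChenQuantumLattice2024, Claim 3.14 p. 33] -/
def omega : ℤ := S.v' 0 / S.D

/-- The point of `|φ7.b⟩` carrying branch `(j,k)`: `2Dj·b + v′/D + (M/(2D))·k` as an integer vector (p. 33,
display of `|φ7.b⟩`; `M/(2D) = DP`). [cite: ChenQuantumLattice2024, §3.5.8 p. 33] -/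
def ctr (j : ℕ) (k : Fin S.n → Fin 2) : Fin (S.n + 1) → ℤ :=
  fun i => 2 * (S.D : ℤ) * j * S.b i + S.v' i / S.D + (S.D : ℤ) * S.P * S.kLift k i

/-- `pt7 j k = D · ctr j k (mod M)`: every point of `|φ7⟩` lies in `Dℤⁿ⁺¹` (p. 33: "we can do so because
`2Djx + v′ + (M/2)k ∈ Dℤⁿ`"). [cite: ChenQuantumLattice2024, §3.5.8 p. 33] -/
theorem pt7_eq_D_mul_ctr (h : S.Admissible) (j : ℕ) (k : Fin S.n → Fin 2) :
    S.pt7 j k = fun i => (((S.D : ℤ) * S.ctr j k i : ℤ) : ZMod S.M) := by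
  funext i
  unfold pt7 ctr
  congr 1
  have hv := Int.mul_ediv_cancel' (h.v'_in_DZ i)
  have hN : ((S.N : ℕ) : ℤ) = (S.D : ℤ) * S.D * S.P := by
    show ((((S.D * S.D * S.P : ℕ+)) : ℕ) : ℤ) = _
    push_cast
    ring
  rw [hN]
  linear_combination (-1 : ℤ) * hv

/-- Coordinate `0` of the centre: `v′₀/D − 2Dj` (`b₀ = −1`, `k₀ = 0`; p. 33 "the first coordinate, `−2Dj + v′/D mod M`").
[cite: ChenQuantumLattice2024, §3.5.8 p. 33] -/
theorem ctr_zero (h : S.Admissible) (j : ℕ) (k : Fin S.n → Fin 2) :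
    S.ctr j k 0 = S.omega - 2 * (S.D : ℤ) * j := by
  simp only [ctr, kLift, Fin.cons_zero, mul_zero, add_zero, h.b_head, omega]
  ring

/-- Coordinates `t+1` of the centre: `2Dj·b_{t+1} + v′_{t+1}/D + DP·k_t`. [cite: ChenQuantumLattice2024, §3.5.8 p. 33] -/
theorem ctr_succ (j : ℕ) (k : Fin S.n → Fin 2) (t : Fin S.n) :
    S.ctr j k t.succ = 2 * (S.D : ℤ) * j * S.b t.succ + S.v' t.succ / S.D + (S.D : ℤ) * S.P * (k t : ℕ) := by
  simp only [ctr, kLift, Fin.cons_succ]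

/-- (8.ii) is performed on a state supported in `Dℤ`: `|φ7.a⟩(z) ≠ 0 ⇒ D ∣ z_i` for all `i` (so measuring
"the modulo-`D` part of the register" returns `0ⁿ⁺¹` with certainty, p. 33). [cite: ChenQuantumLattice2024, §3.5.8 p. 33] -/
theorem phi7a_apply_ne_zero (h : S.Admissible) (z : Fin (S.n + 1) → ZMod ((S.D : ℕ) * S.M))
    (hz : S.phi7a z ≠ 0) (i : Fin (S.n + 1)) : (S.D : ℕ) ∣ (z i).val := by
  unfold phi7a domainExt at hz
  rw [phi7_apply] at hz
  obtain ⟨j, -, hj⟩ := Finset.exists_ne_zero_of_sum_ne_zero hz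
  obtain ⟨k, -, hk⟩ := Finset.exists_ne_zero_of_sum_ne_zero hj
  have heq : (fun i => ZMod.castHom (dvd_mul_left (S.M : ℕ) (S.D : ℕ)) (ZMod S.M) (z i)) = S.pt7 j k := by
    by_contra hne
    exact hk (if_neg hne)
  have hi := congrFun heq i
  rw [S.pt7_eq_D_mul_ctr h] at hi
  simp only [ZMod.castHom_apply, ZMod.cast_eq_val] at hi
  -- `z_i.val ≡ D·c (mod M)` and `D ∣ M`
  have hi' : ((((z i).val : ℕ) : ℤ) : ZMod S.M) = (((S.D : ℤ) * S.ctr j k i : ℤ) : ZMod S.M) := by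
    rw [← hi]
    push_cast
    rfl
  obtain ⟨t, ht⟩ := (ZMod.intCast_eq_intCast_iff_dvd_sub _ _ _).1 hi'
  have hdvd : (S.D : ℤ) ∣ (((z i).val : ℕ) : ℤ) := by
    refine ⟨S.ctr j k i - 2 * S.D * S.P * t, ?_⟩
    rw [S.M_coe] at ht
    linear_combination (-1 : ℤ) * ht
  exact Int.natCast_dvd_natCast.1 hdvd

/-! ### `|φ7.d⟩` as a sum over branches and fibres -/

/-- The weight of a point `y` of `|φ7.b⟩` against the outcome `w` contributed by (8.iii)+(8.iv):
`e(y₀²/(2M))·ψ_M(−⟨y,w⟩)`. [cite: ChenQuantumLattice2024, §3.5.8 p. 33] -/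
noncomputable def G8 (w y : Fin (S.n + 1) → ZMod S.M) : ℂ :=
  e (S.kick8 y) * ZMod.stdAddChar (-(∑ i, y i * w i))

/-- The contribution of branch `(j,k)`: the sum of `G8 w` over the fibre `{y : D·y = pt7 j k}` of (8.i)+(8.ii).
[cite: ChenQuantumLattice2024, §3.5.8 p. 33] -/
noncomputable def inner8 (j : ℕ) (k : Fin S.n → Fin 2) (w : Fin (S.n + 1) → ZMod S.M) : ℂ :=
  ∑ y : Fin (S.n + 1) → ZMod S.M,
    if (fun i => ((S.D : ℕ) : ZMod S.M) * y i) = S.pt7 j k then S.G8 w y else 0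

/-- `|φ7.d⟩(w) = Σ_{j<P} Σ_{k∈{0,1}ⁿ} amp7 j k · inner8 j k w`. [cite: ChenQuantumLattice2024, §3.5.8 p. 33] -/
theorem phi7d_expand (w : Fin (S.n + 1) → ZMod S.M) :
    S.phi7d w = ∑ j ∈ Finset.range S.P, ∑ k : Fin S.n → Fin 2, S.amp7 j k * S.inner8 j k w := by
  unfold phi7d
  rw [qft_apply_eq_sum_stdAddChar]
  unfold phi7c kick inner8 G8
  simp_rw [phi7b_apply, phi7_apply, mul_assoc, Finset.sum_mul, ite_mul, zero_mul]
  rw [Finset.sum_comm]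
  refine Finset.sum_congr rfl fun j _ => ?_
  rw [Finset.sum_comm]
  refine Finset.sum_congr rfl fun k _ => ?_
  rw [Finset.mul_sum]
  refine Finset.sum_congr rfl fun y _ => ?_
  split_ifs <;> simp

/-- Per-coordinate factor of `G8`: coordinate `0` carries the kick. [cite: ChenQuantumLattice2024, §3.5.8 p. 33] -/
noncomputable def g8 (w : Fin (S.n + 1) → ZMod S.M) (i : Fin (S.n + 1)) (x : ZMod S.M) : ℂ :=
  (if i = 0 then e (((x.val : ℕ) : ℚ) ^ 2 / (2 * (S.M : ℕ))) else 1) * ZMod.stdAddChar (-(x * w i))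

/-- The kick-and-QFT weight factorises over coordinates. [folklore] -/
theorem G8_eq_prod (w y : Fin (S.n + 1) → ZMod S.M) : S.G8 w y = ∏ i, S.g8 w i (y i) := by
  unfold G8 g8 kick8
  rw [Finset.prod_mul_distrib, ← stdAddChar_sum_eq_prod, ← Finset.sum_neg_distrib]
  congr 1
  simp

/-- The phase `e(x.val²/(2M))` only depends on `x`'s class: for `x = a mod M`, it is `e(a²/(2M))` (`M` even;
p. 33 remark "the third operation also preserves `M`-periodicity"). [cite: ChenQuantumLattice2024, §3.5.8 p. 33] -/
theorem e_val_sq (a : ℤ) :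
    e ((((((a : ℤ) : ZMod S.M)).val : ℕ) : ℚ) ^ 2 / (2 * (S.M : ℕ)))
      = e (((a ^ 2 : ℤ) : ℚ) / (2 * (S.M : ℕ))) := by
  have hx : (((((a : ℤ) : ZMod S.M)).val : ℕ) : ℤ) = a % (S.M : ℕ) := ZMod.val_intCast a
  have hq : ((S.M : ℕ) : ℤ) * (a / (S.M : ℕ)) + a % (S.M : ℕ) = a := Int.mul_ediv_add_emod a _
  generalize a / (S.M : ℕ) = q at hq
  generalize a % (S.M : ℕ) = r at hq hx
  subst hq
  have hN : ((S.M : ℕ) : ℚ) = 2 * ((S.N : ℕ) : ℚ) := by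
    show ((((2 * S.N : ℕ+)) : ℕ) : ℚ) = _
    push_cast
    ring
  have hN0 : ((S.N : ℕ) : ℚ) ≠ 0 := by exact_mod_cast S.N.ne_zero
  have hxq : ((((((((S.M : ℕ) : ℤ) * q + r : ℤ)) : ZMod S.M)).val : ℕ) : ℚ) = (r : ℚ) := by
    exact_mod_cast hx
  rw [hxq]
  refine e_eq_e_of_sub_eq_intCast (-(r * q + (S.N : ℕ) * q ^ 2)) ?_
  push_cast
  rw [hN]
  field_simp
  ring

/-- Coordinate `0`, one point of the fibre: `g8 w 0 (a mod M) = e(a²/(2M))·e(−a·w₀/M)`.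
[cite: ChenQuantumLattice2024, §3.5.8 p. 33] -/
theorem g8_zero (w : Fin (S.n + 1) → ZMod S.M) (a : ℤ) :
    S.g8 w 0 ((a : ℤ) : ZMod S.M)
      = e (((a ^ 2 : ℤ) : ℚ) / (2 * (S.M : ℕ))) * e (((-(a * (w 0).val) : ℤ) : ℚ) / (S.M : ℕ)) := by
  unfold g8
  rw [if_pos rfl, S.e_val_sq, e_intCast_div_eq_stdAddChar]
  congr 2
  push_cast
  rw [ZMod.natCast_zmod_val]

/-- Coordinates `i ≠ 0`, one point of the fibre: `g8 w i (a mod M) = e(−a·w_i/M)`.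
[cite: ChenQuantumLattice2024, §3.5.8 p. 33] -/
theorem g8_succ (w : Fin (S.n + 1) → ZMod S.M) (t : Fin S.n) (a : ℤ) :
    S.g8 w t.succ ((a : ℤ) : ZMod S.M) = e (((-(a * (w t.succ).val) : ℤ) : ℚ) / (S.M : ℕ)) := by
  unfold g8
  rw [if_neg (Fin.succ_ne_zero t), one_mul, e_intCast_div_eq_stdAddChar]
  congr 1
  push_cast
  rw [ZMod.natCast_zmod_val]

/-- The head indicator of `|φ7.d⟩`: `w₀ ≡ v′₀/D (mod D)`. [cite: ChenQuantumLattice2024, Claim 3.14 p. 33] -/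
def headOK (w : Fin (S.n + 1) → ZMod S.M) : Prop := (((S.omega - (w 0).val : ℤ)) : ZMod S.D) = 0

/-- The tail indicator of `|φ7.d⟩` (= second congruence of Claim 3.14): `D ∣ w_i` for `i ≠ 0`.
[cite: ChenQuantumLattice2024, Claim 3.14 p. 33] -/
def tailOK (w : Fin (S.n + 1) → ZMod S.M) : Prop := ∀ i, i ≠ 0 → (S.D : ℕ) ∣ (w i).val

/-- decidability of the head indicator (a congruence in `ZMod D`). [cite: ChenQuantumLattice2024, §3.5.8 p. 33] -/
instance headOK.decidable (w : Fin (S.n + 1) → ZMod S.M) : Decidable (S.headOK w) := by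
  unfold headOK; infer_instance

/-- decidability of the tail indicator (finitely many divisibilities). [cite: ChenQuantumLattice2024, §3.5.8 p. 33] -/
instance tailOK.decidable (w : Fin (S.n + 1) → ZMod S.M) : Decidable (S.tailOK w) := by
  unfold tailOK; infer_instance

/-- **Coordinate `0`: the kicked fibre sum is an indicator.**
`Σ_{h<D} g8 w 0 (c + 2DP·h) = e(c²/(2M) − c·w₀/M) · D·[c ≡ w₀ (mod D)]`. [cite: ChenQuantumLattice2024, §3.5.8 p. 33] -/
theorem head_fibre_sum (w : Fin (S.n + 1) → ZMod S.M) (c : ℤ) :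
    ∑ hh ∈ Finset.range S.D, S.g8 w 0 (((c + (2 * S.D * S.P : ℕ) * hh : ℤ)) : ZMod S.M)
      = e (((c ^ 2 : ℤ) : ℚ) / (2 * (S.M : ℕ)) - ((c * (w 0).val : ℤ) : ℚ) / (S.M : ℕ))
        * (if (((c - (w 0).val : ℤ)) : ZMod S.D) = 0 then ((S.D : ℕ) : ℂ) else 0) := by
  rw [← sum_range_e_mul_div, Finset.mul_sum]
  refine Finset.sum_congr rfl fun hh _ => ?_
  rw [S.g8_zero, ← e_add, ← e_add]
  refine e_eq_e_of_sub_eq_intCast ((S.P : ℕ) * hh ^ 2) ?_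
  have hD0 : ((S.D : ℕ) : ℚ) ≠ 0 := by exact_mod_cast S.D.ne_zero
  have hP0 : ((S.P : ℕ) : ℚ) ≠ 0 := by exact_mod_cast S.P.ne_zero
  push_cast
  rw [S.M_coe_rat]
  field_simp
  ring

/-- **Coordinates `i ≠ 0`: the plain fibre sum is an indicator.**
`Σ_{h<D} g8 w i (c + 2DP·h) = e(−c·w_i/M) · D·[D ∣ w_i]`. [cite: ChenQuantumLattice2024, §3.5.8 p. 33] -/
theorem tail_fibre_sum (w : Fin (S.n + 1) → ZMod S.M) (t : Fin S.n) (c : ℤ) :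
    ∑ hh ∈ Finset.range S.D, S.g8 w t.succ (((c + (2 * S.D * S.P : ℕ) * hh : ℤ)) : ZMod S.M)
      = e (-((c * (w t.succ).val : ℤ) : ℚ) / (S.M : ℕ))
        * (if (S.D : ℕ) ∣ (w t.succ).val then ((S.D : ℕ) : ℂ) else 0) := by
  have hind : ((S.D : ℕ) ∣ (w t.succ).val) ↔ (((-((w t.succ).val : ℤ) : ℤ)) : ZMod S.D) = 0 := by
    rw [Int.cast_neg, neg_eq_zero, Int.cast_natCast, ZMod.natCast_eq_zero_iff]
  simp only [hind]
  rw [← sum_range_e_mul_div, Finset.mul_sum]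
  refine Finset.sum_congr rfl fun hh _ => ?_
  rw [S.g8_succ, ← e_add]
  congr 1
  have hD0 : ((S.D : ℕ) : ℚ) ≠ 0 := by exact_mod_cast S.D.ne_zero
  have hP0 : ((S.P : ℕ) : ℚ) ≠ 0 := by exact_mod_cast S.P.ne_zero
  push_cast
  rw [S.M_coe_rat]
  field_simp
  ring

/-- One branch, summed over its fibre: `inner8 j k w = D^{n+1}·[headOK w ∧ tailOK w]·e(c₀²/(2M) − ⟨c, w⟩/M)`
with `c = ctr j k`. [cite: ChenQuantumLattice2024, §3.5.8 p. 33] -/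
theorem inner8_eq (h : S.Admissible) (j : ℕ) (k : Fin S.n → Fin 2) (w : Fin (S.n + 1) → ZMod S.M) :
    S.inner8 j k w
      = (if S.headOK w ∧ S.tailOK w then ((S.D : ℕ) : ℂ) ^ (S.n + 1) else 0)
        * e ((((S.ctr j k 0) ^ 2 : ℤ) : ℚ) / (2 * (S.M : ℕ))
            - ((∑ i, S.ctr j k i * (w i).val : ℤ) : ℚ) / (S.M : ℕ)) := by
  classical
  -- the fibre condition coordinatewise, and the summand as a product over coordinates
  have hterm : ∀ y : Fin (S.n + 1) → ZMod S.M,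
      (if (fun i => ((S.D : ℕ) : ZMod S.M) * y i) = S.pt7 j k then S.G8 w y else 0)
        = ∏ i, (if ((S.D : ℕ) : ZMod S.M) * y i = (((S.D : ℤ) * S.ctr j k i : ℤ) : ZMod S.M)
                  then S.g8 w i (y i) else 0) := by
    intro y
    rw [G8_eq_prod, S.pt7_eq_D_mul_ctr h, Fintype.prod_ite_zero]
    by_cases hall : ∀ i, ((S.D : ℕ) : ZMod S.M) * y i = (((S.D : ℤ) * S.ctr j k i : ℤ) : ZMod S.M)
    · rw [if_pos hall, if_pos (funext hall)]
    · rw [if_neg hall, if_neg (fun heq => hall (fun i => congrFun heq i))]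
  unfold inner8
  simp_rw [hterm]
  rw [← Fintype.prod_sum (fun i x => if ((S.D : ℕ) : ZMod S.M) * x
      = (((S.D : ℤ) * S.ctr j k i : ℤ) : ZMod S.M) then S.g8 w i x else 0)]
  have hML : ((S.M : ℕ) : ℤ) = (S.D : ℕ) * (2 * S.D * S.P : ℕ) := by
    rw [S.M_coe]
    push_cast
    ring
  simp_rw [sum_fibre_D_mul (S.M : ℕ) S.D (2 * S.D * S.P) hML]
  rw [Fin.prod_univ_succ, S.head_fibre_sum]
  simp_rw [S.tail_fibre_sum]
  rw [Finset.prod_mul_distrib, Fintype.prod_ite_zero, Finset.prod_const, Finset.card_univ,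
    Fintype.card_fin, ← e_sum, Fin.sum_univ_succ (fun i => S.ctr j k i * ((w i).val : ℤ))]
  -- the head indicator does not depend on `j`
  have hhead : ((((S.ctr j k 0 - (w 0).val : ℤ)) : ZMod S.D) = 0) ↔ S.headOK w := by
    unfold headOK
    rw [intCast_eq_of_sub_eq_mul (N := S.D) (S.ctr j k 0 - (w 0).val) (S.omega - (w 0).val)
      (-(2 * j * S.b 0)) (by simp only [ctr, kLift, Fin.cons_zero, omega]; ring)]
  have htail : (∀ t : Fin S.n, (S.D : ℕ) ∣ (w t.succ).val) ↔ S.tailOK w := by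
    constructor
    · intro ht i hi
      obtain ⟨t, rfl⟩ := Fin.exists_succ_eq.2 hi
      exact ht t
    · intro ht t
      exact ht _ (Fin.succ_ne_zero t)
  simp only [hhead, htail]
  -- bookkeeping of the phases
  have hphase : e ((((S.ctr j k 0) ^ 2 : ℤ) : ℚ) / (2 * (S.M : ℕ)) - ((S.ctr j k 0 * (w 0).val : ℤ) : ℚ) / (S.M : ℕ))
      * e (∑ t : Fin S.n, -(((S.ctr j k t.succ * (w t.succ).val : ℤ)) : ℚ) / (S.M : ℕ))
      = e ((((S.ctr j k 0) ^ 2 : ℤ) : ℚ) / (2 * (S.M : ℕ))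
          - (((S.ctr j k 0 * ((w 0).val : ℤ) + ∑ t : Fin S.n, S.ctr j k t.succ * ((w t.succ).val : ℤ) : ℤ))
              : ℚ) / (S.M : ℕ)) := by
    rw [← e_add]
    congr 1
    push_cast
    simp only [neg_div, Finset.sum_neg_distrib]
    rw [← Finset.sum_div]
    ring
  by_cases hc : S.headOK w ∧ S.tailOK w
  · rw [if_pos hc, if_pos hc.1, if_pos hc.2, ← hphase]
    ring
  · rw [if_neg hc]
    simp only [zero_mul]
    rcases not_and_or.1 hc with h1 | h2
    · rw [if_neg h1]
      ring
    · rw [if_neg h2]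
      ring

/-! ### The `j`-sum and the `k`-sum -/

/-- `t(w) := ⟨b, w⟩ + v′₀/D` on canonical representatives — the integer of the first congruence of Claim 3.14.
[cite: ChenQuantumLattice2024, Claim 3.14 p. 33] -/
def tInt (w : Fin (S.n + 1) → ZMod S.M) : ℤ := ∑ i, S.b i * ((w i).val : ℤ) + S.v' 0 / S.D

/-- The `w`-dependent phase common to all branches: `ω²/(2M) − ⟨v′/D, w⟩/M` (in turns).
[cite: ChenQuantumLattice2024, §3.5.8 p. 33] -/
def basePhase (w : Fin (S.n + 1) → ZMod S.M) : ℚ :=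
  ((S.omega ^ 2 : ℤ) : ℚ) / (2 * (S.M : ℕ)) - ((∑ i, (S.v' i / S.D) * (w i).val : ℤ) : ℚ) / (S.M : ℕ)

/-- The `j`-sum of `|φ7.d⟩(w)`: `Σ_{j<P} e(−2Dj·t(w)/M)` (p. 33: "the only term … that depends on `j`").
[cite: ChenQuantumLattice2024, proof of Claim 3.14 p. 33] -/
noncomputable def jSum (w : Fin (S.n + 1) → ZMod S.M) : ℂ :=
  ∑ j ∈ Finset.range S.P, e (-(((2 * (S.D : ℤ) * j * S.tInt w : ℤ)) : ℚ) / (S.M : ℕ))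

/-- The `k`-sum of `|φ7.d⟩(w)`: `Σ_{k∈{0,1}ⁿ} e(‖k‖²/4 − ⟨k, w_{1..n}⟩/(2D))` (p. 33, with `(M/(2D))·k` read in `ℤ_M`).
[cite: ChenQuantumLattice2024, proof of Claim 3.14 p. 33] -/
noncomputable def kSum (w : Fin (S.n + 1) → ZMod S.M) : ℂ :=
  ∑ k : Fin S.n → Fin 2, e ((∑ t, ((k t : ℕ) : ℚ) ^ 2) / 4
    - (((S.D : ℤ) * S.P * ∑ t, ((k t : ℕ) : ℤ) * (w t.succ).val : ℤ) : ℚ) / (S.M : ℕ))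

/-- `Σ_i Σ_j a·f(i)·g(j) = a·(Σ f)·(Σ g)`. [folklore] -/
theorem sum_sum_mul_mul {ι κ : Type*} (s : Finset ι) (t : Finset κ) (a : ℂ) (f : ι → ℂ) (g : κ → ℂ) :
    ∑ i ∈ s, ∑ j ∈ t, a * f i * g j = a * (∑ i ∈ s, f i) * ∑ j ∈ t, g j := by
  rw [mul_assoc, Finset.sum_mul_sum, Finset.mul_sum]
  refine Finset.sum_congr rfl fun i _ => ?_
  rw [Finset.mul_sum]
  refine Finset.sum_congr rfl fun j _ => ?_
  ring

/-- One branch against `w`, phases collected: the chirp `e(−j²/P)` cancels against the kick (p. 33: "so as to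
remove the quadratic term of `j`"), leaving `e(−2Dj(⟨b,w⟩ + v′₀/D)/M)` and the `k`-phase.
[cite: ChenQuantumLattice2024, §3.5.8 p. 33] -/
theorem amp7_mul_inner8 (h : S.Admissible) (j : ℕ) (k : Fin S.n → Fin 2) (w : Fin (S.n + 1) → ZMod S.M) :
    S.amp7 j k * S.inner8 j k w
      = (if S.headOK w ∧ S.tailOK w then ((S.D : ℕ) : ℂ) ^ (S.n + 1) else 0) * e (S.basePhase w)
        * e (-(((2 * (S.D : ℤ) * j * S.tInt w : ℤ)) : ℚ) / (S.M : ℕ))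
        * e ((∑ t, ((k t : ℕ) : ℚ) ^ 2) / 4
              - (((S.D : ℤ) * S.P * ∑ t, ((k t : ℕ) : ℤ) * (w t.succ).val : ℤ) : ℚ) / (S.M : ℕ)) := by
  rw [S.inner8_eq h]
  unfold amp7 basePhase
  have hsum : (∑ i, S.ctr j k i * ((w i).val : ℤ))
      = 2 * S.D * j * (∑ i, S.b i * ((w i).val : ℤ)) + (∑ i, (S.v' i / S.D) * ((w i).val : ℤ))
        + S.D * S.P * ∑ t, ((k t : ℕ) : ℤ) * ((w t.succ).val : ℤ) := by
    have hk : (∑ i, S.kLift k i * ((w i).val : ℤ)) = ∑ t, ((k t : ℕ) : ℤ) * ((w t.succ).val : ℤ) := by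
      rw [Fin.sum_univ_succ]
      simp [kLift]
    rw [← hk]
    simp only [ctr, Finset.mul_sum, ← Finset.sum_add_distrib]
    refine Finset.sum_congr rfl fun i _ => ?_
    ring
  have hc0 := S.ctr_zero h j k
  have key : e (-((j : ℚ) ^ 2) / S.P) * e ((∑ t, ((k t : ℕ) : ℚ) ^ 2) / 4)
      * e ((((S.ctr j k 0) ^ 2 : ℤ) : ℚ) / (2 * (S.M : ℕ))
            - ((∑ i, S.ctr j k i * (w i).val : ℤ) : ℚ) / (S.M : ℕ))
      = e (((S.omega ^ 2 : ℤ) : ℚ) / (2 * (S.M : ℕ))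
            - ((∑ i, (S.v' i / S.D) * (w i).val : ℤ) : ℚ) / (S.M : ℕ))
        * e (-(((2 * (S.D : ℤ) * j * S.tInt w : ℤ)) : ℚ) / (S.M : ℕ))
        * e ((∑ t, ((k t : ℕ) : ℚ) ^ 2) / 4
              - (((S.D : ℤ) * S.P * ∑ t, ((k t : ℕ) : ℤ) * (w t.succ).val : ℤ) : ℚ) / (S.M : ℕ)) := by
    rw [← e_add, ← e_add, ← e_add, ← e_add]
    congr 1
    rw [hsum, hc0]
    unfold tInt omega
    have hD0 : ((S.D : ℕ) : ℚ) ≠ 0 := by exact_mod_cast S.D.ne_zero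
    have hP0 : ((S.P : ℕ) : ℚ) ≠ 0 := by exact_mod_cast S.P.ne_zero
    push_cast
    rw [S.M_coe_rat]
    field_simp
    ring
  linear_combination (if S.headOK w ∧ S.tailOK w then ((S.D : ℕ) : ℂ) ^ (S.n + 1) else 0) * key

/-- **`|φ7.d⟩` factorised:** indicator × unit phase × `j`-sum × `k`-sum. [cite: ChenQuantumLattice2024, §3.5.8 p. 33] -/
theorem phi7d_eq (h : S.Admissible) (w : Fin (S.n + 1) → ZMod S.M) :
    S.phi7d w = (if S.headOK w ∧ S.tailOK w then ((S.D : ℕ) : ℂ) ^ (S.n + 1) else 0) * e (S.basePhase w)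
      * S.jSum w * S.kSum w := by
  rw [S.phi7d_expand]
  simp_rw [S.amp7_mul_inner8 h]
  exact sum_sum_mul_mul _ _ _ _ _

/-- **The `j`-sum is an indicator** (p. 33): on the head/tail indicators `D ∣ t(w)`, and then
`Σ_{j<P} e(−2Dj·t/M) = Σ_{j∈ℤ_P} e(−j(t/D)/P) = P·[DP ∣ t(w)]`. [cite: ChenQuantumLattice2024, proof of Claim 3.14 p. 33] -/
theorem jSum_eq (h : S.Admissible) (w : Fin (S.n + 1) → ZMod S.M) (hw : S.headOK w ∧ S.tailOK w) :
    S.jSum w = if ((S.D : ℤ) * S.P ∣ S.tInt w) then ((S.P : ℕ) : ℂ) else 0 := by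
  have hDt : (S.D : ℤ) ∣ S.tInt w := by
    have ht : S.tInt w = (S.omega - (w 0).val) + ∑ t : Fin S.n, S.b t.succ * ((w t.succ).val : ℤ) := by
      unfold tInt omega
      rw [Fin.sum_univ_succ, h.b_head]
      ring
    rw [ht]
    refine dvd_add ((ZMod.intCast_zmod_eq_zero_iff_dvd _ _).1 hw.1) (Finset.dvd_sum fun t _ => ?_)
    exact dvd_mul_of_dvd_right (Int.natCast_dvd_natCast.2 (hw.2 _ (Fin.succ_ne_zero t))) _
  obtain ⟨t', ht'⟩ := hDt
  have hD0 : (S.D : ℤ) ≠ 0 := by exact_mod_cast S.D.ne_zero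
  have hiff : ((S.D : ℤ) * S.P ∣ S.tInt w) ↔ (((-t' : ℤ)) : ZMod S.P) = 0 := by
    rw [ht', Int.cast_neg, neg_eq_zero, ZMod.intCast_zmod_eq_zero_iff_dvd, mul_dvd_mul_iff_left hD0]
  simp only [hiff]
  rw [jSum, ← sum_range_e_mul_div]
  refine Finset.sum_congr rfl fun j _ => ?_
  congr 1
  rw [ht']
  have hD0' : ((S.D : ℕ) : ℚ) ≠ 0 := by exact_mod_cast S.D.ne_zero
  have hP0 : ((S.P : ℕ) : ℚ) ≠ 0 := by exact_mod_cast S.P.ne_zero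
  push_cast
  rw [S.M_coe_rat]
  field_simp

/-- **The `k`-sum is a product of `n` factors `1 + e(1/4 − DP·w_t/M)`** (the sum over `k ∈ {0,1}ⁿ` factorises).
[cite: ChenQuantumLattice2024, proof of Claim 3.14 p. 33] -/
theorem kSum_eq_prod (w : Fin (S.n + 1) → ZMod S.M) :
    S.kSum w = ∏ t : Fin S.n, (1 + e (1 / 4 - (((S.D : ℤ) * S.P * (w t.succ).val : ℤ) : ℚ) / (S.M : ℕ))) := by
  classical
  unfold kSum
  have hterm : ∀ k : Fin S.n → Fin 2,
      e ((∑ t, ((k t : ℕ) : ℚ) ^ 2) / 4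
          - (((S.D : ℤ) * S.P * ∑ t, ((k t : ℕ) : ℤ) * (w t.succ).val : ℤ) : ℚ) / (S.M : ℕ))
        = ∏ t, e ((((k t : ℕ) : ℚ) ^ 2) / 4
          - (((S.D : ℤ) * S.P * (((k t : ℕ) : ℤ) * (w t.succ).val) : ℤ) : ℚ) / (S.M : ℕ)) := by
    intro k
    rw [← e_sum]
    congr 1
    push_cast
    rw [Finset.sum_div, Finset.mul_sum, Finset.sum_div, ← Finset.sum_sub_distrib]
  simp_rw [hterm]
  rw [← Fintype.prod_sum (fun (t : Fin S.n) (x : Fin 2) => e ((((x : ℕ) : ℚ) ^ 2) / 4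
      - (((S.D : ℤ) * S.P * (((x : ℕ) : ℤ) * (w t.succ).val) : ℤ) : ℚ) / (S.M : ℕ)))]
  refine Finset.prod_congr rfl fun t _ => ?_
  rw [Fin.sum_univ_two]
  congr 1
  · convert e_intCast 0 using 2
    push_cast
    simp
  · congr 1
    push_cast
    simp

/-- On the tail indicator every factor is `1 ± i`: `‖kSum w‖² = 2ⁿ`.
[cite: ChenQuantumLattice2024, proof of Claim 3.14 p. 33] -/
theorem norm_sq_kSum (w : Fin (S.n + 1) → ZMod S.M) (hw : S.tailOK w) : ‖S.kSum w‖ ^ 2 = 2 ^ S.n := by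
  rw [S.kSum_eq_prod, norm_prod, ← Finset.prod_pow]
  have hfac : ∀ t : Fin S.n,
      ‖1 + e (1 / 4 - (((S.D : ℤ) * S.P * (w t.succ).val : ℤ) : ℚ) / (S.M : ℕ))‖ ^ 2 = 2 := by
    intro t
    obtain ⟨m, hm⟩ := hw _ (Fin.succ_ne_zero t)
    have hq : (((S.D : ℤ) * S.P * (w t.succ).val : ℤ) : ℚ) / (S.M : ℕ) = (((m : ℕ) : ℤ) : ℚ) / 2 := by
      rw [hm]
      have hD0 : ((S.D : ℕ) : ℚ) ≠ 0 := by exact_mod_cast S.D.ne_zero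
      have hP0 : ((S.P : ℕ) : ℚ) ≠ 0 := by exact_mod_cast S.P.ne_zero
      push_cast
      rw [S.M_coe_rat]
      field_simp
    rw [hq]
    exact norm_sq_one_add_e m
  simp_rw [hfac]
  rw [Finset.prod_const, Finset.card_univ, Fintype.card_fin]

/-! ### The law of `|φ7.d⟩` -/

/-- **The support predicate of `|φ7.d⟩`:** `D ∣ w_i (i ≠ 0)` and `DP = M/(2D) ∣ ⟨b,w⟩ + v′₀/D` — the first two
congruences of Claim 3.14 (they imply `w₀ ≡ v′₀/D (mod D)`, `headOK_of_pred8`).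
[cite: ChenQuantumLattice2024, Claim 3.14 p. 33] -/
def pred8 (w : Fin (S.n + 1) → ZMod S.M) : Prop := S.tailOK w ∧ ((S.D : ℤ) * S.P ∣ S.tInt w)

/-- The support predicate implies the head indicator `w₀ ≡ v′₀/D (mod D)` (since `D ∣ DP ∣ t(w)` and `D ∣ w_i`).
[cite: ChenQuantumLattice2024, Claim 3.14 p. 33] -/
theorem headOK_of_pred8 (h : S.Admissible) {w : Fin (S.n + 1) → ZMod S.M} (hw : S.pred8 w) : S.headOK w := by
  unfold headOK
  rw [ZMod.intCast_zmod_eq_zero_iff_dvd]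
  have ht : S.omega - (w 0).val = S.tInt w - ∑ t : Fin S.n, S.b t.succ * ((w t.succ).val : ℤ) := by
    unfold tInt omega
    rw [Fin.sum_univ_succ, h.b_head]
    ring
  rw [ht]
  refine dvd_sub ((dvd_mul_right _ _).trans hw.2) (Finset.dvd_sum fun t _ => ?_)
  exact dvd_mul_of_dvd_right (Int.natCast_dvd_natCast.2 (hw.1 _ (Fin.succ_ne_zero t))) _

/-- Off the support predicate the amplitude vanishes. [cite: ChenQuantumLattice2024, Claim 3.14 p. 33] -/
theorem phi7d_eq_zero_of_not_pred8 (h : S.Admissible) {w : Fin (S.n + 1) → ZMod S.M} (hw : ¬ S.pred8 w) :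
    S.phi7d w = 0 := by
  rw [S.phi7d_eq h]
  by_cases hc : S.headOK w ∧ S.tailOK w
  · have hdvd : ¬ ((S.D : ℤ) * S.P ∣ S.tInt w) := fun hd => hw ⟨hc.2, hd⟩
    rw [S.jSum_eq h w hc, if_neg hdvd]
    simp
  · rw [if_neg hc]
    simp

/-- On the support predicate: `|φ7.d⟩(w) = D^{n+1}·e(basePhase w)·P·kSum w`. [cite: ChenQuantumLattice2024, §3.5.8 p. 33] -/
theorem phi7d_eq_of_pred8 (h : S.Admissible) {w : Fin (S.n + 1) → ZMod S.M} (hw : S.pred8 w) :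
    S.phi7d w = ((S.D : ℕ) : ℂ) ^ (S.n + 1) * e (S.basePhase w) * ((S.P : ℕ) : ℂ) * S.kSum w := by
  have hc : S.headOK w ∧ S.tailOK w := ⟨S.headOK_of_pred8 h hw, hw.1⟩
  rw [S.phi7d_eq h, S.jSum_eq h w hc, if_pos hc, if_pos hw.2]

/-- **The law of `|φ7.d⟩` is uniform on its support:** `‖|φ7.d⟩(w)‖² = (D^{n+1}P)²·2ⁿ` for every `w` with `pred8 w`.
[cite: ChenQuantumLattice2024, §3.5.8 p. 33] -/
theorem norm_sq_phi7d_of_pred8 (h : S.Admissible) {w : Fin (S.n + 1) → ZMod S.M} (hw : S.pred8 w) :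
    ‖S.phi7d w‖ ^ 2 = (((S.D : ℕ) : ℝ) ^ (S.n + 1) * (S.P : ℕ)) ^ 2 * 2 ^ S.n := by
  rw [S.phi7d_eq_of_pred8 h hw, norm_mul, norm_mul, norm_mul, norm_e, norm_pow, Complex.norm_natCast,
    Complex.norm_natCast, mul_pow, mul_pow, mul_pow, S.norm_sq_kSum w hw.1]
  ring

/-- **The exact support of `|φ7.d⟩`:** `|φ7.d⟩(w) ≠ 0 ↔ (D ∣ w_i for i ≠ 0) ∧ DP ∣ ⟨b,w⟩ + v′₀/D`.
[cite: ChenQuantumLattice2024, Claim 3.14 p. 33] -/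
theorem phi7d_ne_zero_iff (h : S.Admissible) (w : Fin (S.n + 1) → ZMod S.M) : S.phi7d w ≠ 0 ↔ S.pred8 w := by
  constructor
  · intro hne
    by_contra hw
    exact hne (S.phi7d_eq_zero_of_not_pred8 h hw)
  · intro hw hzero
    have key := S.norm_sq_phi7d_of_pred8 h hw
    rw [hzero, norm_zero] at key
    have hD : (0 : ℝ) < ((S.D : ℕ) : ℝ) := by exact_mod_cast S.D.pos
    have hP : (0 : ℝ) < ((S.P : ℕ) : ℝ) := by exact_mod_cast S.P.pos
    have hpos : (0 : ℝ) < (((S.D : ℕ) : ℝ) ^ (S.n + 1) * (S.P : ℕ)) ^ 2 * 2 ^ S.n := by positivity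
    have h0 : ((0 : ℝ)) ^ 2 = 0 := by norm_num
    rw [h0] at key
    linarith

/-- `|φ7.d⟩ ≠ 0` (the point `(v′₀/D, 0, …, 0)` is in the support). [cite: ChenQuantumLattice2024, Claim 3.14 p. 33] -/
theorem phi7d_ne_zero (h : S.Admissible) : S.phi7d ≠ 0 := by
  intro hzero
  have hw : S.pred8 (Fin.cons (((S.omega : ℤ)) : ZMod S.M) (fun _ => 0) : Fin (S.n + 1) → ZMod S.M) := by
    refine ⟨fun i hi => ?_, ?_⟩
    · obtain ⟨t, rfl⟩ := Fin.exists_succ_eq.2 hi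
      simp
    · unfold tInt
      rw [Fin.sum_univ_succ, h.b_head]
      simp only [Fin.cons_zero, Fin.cons_succ, ZMod.val_zero, Nat.cast_zero, mul_zero,
        Finset.sum_const_zero, add_zero]
      have h0 : (((((S.omega : ℤ)) : ZMod S.M)).val : ℤ) = S.omega % (S.M : ℕ) := ZMod.val_intCast _
      rw [h0]
      have hdiv := Int.mul_ediv_add_emod S.omega (S.M : ℕ)
      have hM := S.M_coe
      unfold omega at *
      exact ⟨2 * S.D * (S.v' 0 / S.D / (S.M : ℕ)), by linear_combination (-1 : ℤ) * hdiv + (S.v' 0 / S.D / (S.M : ℕ)) * hM⟩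
  exact (S.phi7d_ne_zero_iff h _).2 hw (by rw [hzero]; rfl)

/-! ### Claim 3.14 holds -/

/-- On the support, `w₀ ≡ v′₀/D (mod D·g)` for every `g ∣ P` dividing all `b_i (i ≠ 0)` — the third congruence
of Claim 3.14 is the case `g = p₁` (eq. (12): `b ∈ −1 | 2p₁ℤⁿ`; C.3: `Dp₁ ∣ M/(2D)`).
[cite: ChenQuantumLattice2024, proof of Claim 3.14 pp. 33–34] -/
theorem head_residue_of_pred8 (h : S.Admissible) {g : ℕ} (hg : g ∣ (S.P : ℕ))
    (hb : ∀ i, i ≠ 0 → (g : ℤ) ∣ S.b i) {w : Fin (S.n + 1) → ZMod S.M} (hw : S.pred8 w) :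
    (((w 0).val : ℤ) : ZMod ((S.D : ℕ) * g)) = ((S.v' 0 / S.D : ℤ) : ZMod ((S.D : ℕ) * g)) := by
  rw [ZMod.intCast_eq_intCast_iff_dvd_sub]
  have ht : S.v' 0 / S.D - (w 0).val = S.tInt w - ∑ t : Fin S.n, S.b t.succ * ((w t.succ).val : ℤ) := by
    unfold tInt
    rw [Fin.sum_univ_succ, h.b_head]
    ring
  rw [ht]
  push_cast
  refine dvd_sub ?_ (Finset.dvd_sum fun t _ => ?_)
  · obtain ⟨q, hq⟩ := hg
    refine (?_ : (S.D : ℤ) * g ∣ (S.D : ℤ) * S.P).trans hw.2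
    exact mul_dvd_mul_left _ ⟨q, by exact_mod_cast hq⟩
  · rw [mul_comm ((S.D : ℕ) : ℤ)]
    exact mul_dvd_mul (hb _ (Fin.succ_ne_zero t)) (Int.natCast_dvd_natCast.2 (hw.1 _ (Fin.succ_ne_zero t)))

/-- **Claim 3.14 (p. 33) is CORRECT for the state Step 8 produces**: every outcome of measuring `|φ7.d⟩`
satisfies `⟨b,w⟩ + v′₀/D ≡ 0 (mod M/(2D))`, `w_{1..n} ∈ Dℤⁿ`, `w₀ ≡ v′₀/D (mod Dp₁)` — a kernel-checked
confirmation, in the register model of §2, of the author's 18-April note on p. 32 ("the domain extension trick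
applied here is correct"): Step 8, unlike Step 9, is sound.  Hence the fifth operation (p. 34) reads
`v′₀ mod D²p₁ = step8Output` with certainty and, the read statistic being almost surely constant, without
disturbing the state (Lemma 3.13). [cite: ChenQuantumLattice2024, Lemma 3.13 p. 32, Claim 3.14 p. 33] -/
theorem claim314_phi7d (h : S.Admissible) : S.Claim314 S.phi7d := by
  intro w hw
  have hp := (S.phi7d_ne_zero_iff h w).1 hw
  refine ⟨?_, hp.1, ?_⟩
  · haveI : NeZero ((S.M : ℕ) / (2 * S.D)) :=
      ⟨by rw [S.M_div_two_D]; exact Nat.mul_ne_zero S.D.ne_zero S.P.ne_zero⟩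
    rw [ZMod.intCast_zmod_eq_zero_iff_dvd]
    have hMD : ((((S.M : ℕ) / (2 * S.D) : ℕ)) : ℤ) = (S.D : ℤ) * S.P := by
      rw [S.M_div_two_D]
      push_cast
      ring
    rw [hMD]
    exact hp.2
  · exact S.head_residue_of_pred8 h ⟨S.Q, rfl⟩
      (fun i hi => (dvd_mul_left (S.p₁ : ℤ) 2).trans (h.b_tail i hi)) hp

/-! ### The Step-8 ceiling -/

/-- The witness outcome for the index `t₀+1`: `w₀ = v′₀/D + D·b_{t₀+1}`, `w_{t₀+1} = D`, all other coordinates `0`.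
[cite: ChenQuantumLattice2024, Claim 3.14 p. 33, eq. (12) p. 17] -/
def wit (t₀ : Fin S.n) : Fin (S.n + 1) → ZMod S.M :=
  Fin.cons (((S.omega + S.D * S.b t₀.succ : ℤ)) : ZMod S.M)
    (fun t => if t = t₀ then ((S.D : ℕ) : ZMod S.M) else 0)

/-- Tail coordinates of the witness on representatives: `D` at `t₀`, else `0`.
[cite: ChenQuantumLattice2024, §3.5.8 p. 33] -/
theorem wit_succ_val (t₀ t : Fin S.n) :
    ((S.wit t₀ t.succ).val : ℤ) = if t = t₀ then (S.D : ℤ) else 0 := by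
  unfold wit
  rw [Fin.cons_succ]
  split_ifs
  · rw [ZMod.val_cast_of_lt S.D_lt_M]
  · rw [ZMod.val_zero]
    rfl

/-- Head coordinate of the witness on representatives: `(v′₀/D + D·b_{t₀+1}) mod M`.
[cite: ChenQuantumLattice2024, §3.5.8 p. 33] -/
theorem wit_zero_val (t₀ : Fin S.n) :
    (((S.wit t₀ 0).val : ℕ) : ℤ) = (S.omega + S.D * S.b t₀.succ) % (S.M : ℕ) := by
  unfold wit
  rw [Fin.cons_zero]
  exact ZMod.val_intCast _

/-- `t(witness)` is a multiple of `M`. [cite: ChenQuantumLattice2024, §3.5.8 p. 33] -/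
theorem tInt_wit (h : S.Admissible) (t₀ : Fin S.n) :
    S.tInt (S.wit t₀) = (S.M : ℕ) * ((S.omega + S.D * S.b t₀.succ) / (S.M : ℕ)) := by
  unfold tInt
  rw [Fin.sum_univ_succ, h.b_head]
  simp_rw [S.wit_succ_val, mul_ite, mul_zero]
  rw [Finset.sum_ite_eq' Finset.univ t₀, if_pos (Finset.mem_univ _), S.wit_zero_val]
  have hdiv := Int.mul_ediv_add_emod (S.omega + S.D * S.b t₀.succ) (S.M : ℕ)
  unfold omega at *
  linear_combination (-1 : ℤ) * hdiv

/-- The witness is in the support of `|φ7.d⟩`. [cite: ChenQuantumLattice2024, Claim 3.14 p. 33] -/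
theorem pred8_wit (h : S.Admissible) (t₀ : Fin S.n) : S.pred8 (S.wit t₀) := by
  refine ⟨fun i hi => ?_, ?_⟩
  · obtain ⟨t, rfl⟩ := Fin.exists_succ_eq.2 hi
    unfold wit
    rw [Fin.cons_succ]
    split_ifs
    · rw [ZMod.val_cast_of_lt S.D_lt_M]
    · rw [ZMod.val_zero]
      exact dvd_zero _
  · rw [S.tInt_wit h t₀]
    exact ⟨2 * S.D * ((S.omega + S.D * S.b t₀.succ) / (S.M : ℕ)), by rw [S.M_coe]; ring⟩

/-- **THE STEP-8 CEILING** (this bundle's diagnosis `STEPS.md` §4.3, `REPAIR-CENSUS.md` T7).  For a divisor `g` of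
`P`, measuring `|φ7.d⟩` determines `w₀ ≡ v′₀/D (mod D·g)` with certainty **iff** `g` divides every `b_i (i ≠ 0)`.
Under eq. (12) alone (`2p₁ ∣ b_i`, `b` otherwise unknown: it contains the LWE secret and error) the modulus `Dp₁`
of Claim 3.14 — i.e. `v′₀ mod D²p₁` — is therefore the most Step 8 can certify about `v′₀`; what Step 9 consumes
is `v′₀ mod D²P` (`step9Needs`), a factor `Q = P/p₁ ≥ 3` finer.  (`⇒`: the outcome
`(v′₀/D + D·b_i, 0, …, D, …, 0)` has non-zero amplitude.)
[cite: ChenQuantumLattice2024, Claim 3.14 p. 33, eq. (12) p. 17, §3.5.9 p. 37] -/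
theorem step8_ceiling_iff (h : S.Admissible) {g : ℕ} (hg : g ∣ (S.P : ℕ)) :
    (∀ w, S.phi7d w ≠ 0 →
        (((w 0).val : ℤ) : ZMod ((S.D : ℕ) * g)) = ((S.v' 0 / S.D : ℤ) : ZMod ((S.D : ℕ) * g)))
      ↔ ∀ i, i ≠ 0 → (g : ℤ) ∣ S.b i := by
  constructor
  · intro H i hi
    obtain ⟨t₀, rfl⟩ := Fin.exists_succ_eq.2 hi
    have hw := H (S.wit t₀) ((S.phi7d_ne_zero_iff h _).2 (S.pred8_wit h t₀))
    rw [ZMod.intCast_eq_intCast_iff_dvd_sub, S.wit_zero_val] at hw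
    have hw' : (S.D : ℤ) * g ∣ S.omega - (S.omega + S.D * S.b t₀.succ) % (S.M : ℕ) := by
      unfold omega
      exact_mod_cast hw
    have hdiv := Int.mul_ediv_add_emod (S.omega + S.D * S.b t₀.succ) (S.M : ℕ)
    have hgM : (S.D : ℤ) * g ∣ ((S.M : ℕ) : ℤ) := by
      obtain ⟨q, hq⟩ := hg
      rw [S.M_coe, show ((S.P : ℕ) : ℤ) = g * q by exact_mod_cast hq]
      exact ⟨2 * S.D * q, by ring⟩
    have hD0 : (S.D : ℤ) ≠ 0 := by exact_mod_cast S.D.ne_zero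
    have key : (S.D : ℤ) * g ∣ (S.D : ℤ) * S.b t₀.succ := by
      have e1 : (S.D : ℤ) * S.b t₀.succ
          = -(S.omega - (S.omega + S.D * S.b t₀.succ) % (S.M : ℕ))
            + (S.M : ℕ) * ((S.omega + S.D * S.b t₀.succ) / (S.M : ℕ)) := by
        linear_combination (-1 : ℤ) * hdiv
      rw [e1]
      exact dvd_add (dvd_neg.2 hw') (hgM.trans (dvd_mul_right _ _))
    exact (mul_dvd_mul_iff_left hD0).1 key
  · intro hb w hw
    exact S.head_residue_of_pred8 h hg hb ((S.phi7d_ne_zero_iff h w).1 hw)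

/-- The ceiling at the two ends: `g = p₁` is certified (Claim 3.14); `g = P` (what Step 9 needs, `v′₀ mod D²P`) is
certified iff `P ∣ b_i` for all `i ≠ 0`, which eq. (12) does not provide.
[cite: ChenQuantumLattice2024, Claim 3.14 p. 33, eq. (12) p. 17] -/
theorem step8_certifies_mod_DP_iff (h : S.Admissible) :
    (∀ w, S.phi7d w ≠ 0 →
        (((w 0).val : ℤ) : ZMod ((S.D : ℕ) * S.P)) = ((S.v' 0 / S.D : ℤ) : ZMod ((S.D : ℕ) * S.P)))
      ↔ ∀ i, i ≠ 0 → ((S.P : ℕ) : ℤ) ∣ S.b i :=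
  S.step8_ceiling_iff h (dvd_refl _)

/-! ### The information ceiling: no read-out of Step 8 does better -/

/-- The instances Step 8 must serve: the same public `n, D, p₁, Q` (and Step-9 data `b*, v*`, irrelevant here) with
ANY admissible `b` (it contains the LWE secret and error, eq. (12)) and `v′` (a measurement history, eq. (35)).
[cite: ChenQuantumLattice2024, eq. (12) p. 17, eq. (35) p. 31] -/
abbrev inst (b₂ v₂ : Fin (S.n + 1) → ℤ) : Shape := S.withVectors b₂ v₂ S.bstar S.vstar

/-- Any `b ∈ −1 | 2p₁ℤⁿ` and `v′ ∈ Dℤⁿ⁺¹` give an admissible instance with the same public data.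
[cite: ChenQuantumLattice2024, eq. (12) p. 17, eq. (35) p. 31] -/
theorem inst_admissible (h : S.Admissible) {b₂ v₂ : Fin (S.n + 1) → ℤ} (hb0 : b₂ 0 = -1)
    (hbt : ∀ i, i ≠ 0 → (2 * (S.p₁ : ℤ)) ∣ b₂ i) (hv : ∀ i, (S.D : ℤ) ∣ v₂ i) :
    (S.inst b₂ v₂).Admissible :=
  ⟨h.odd_D, h.odd_p₁, h.odd_Q, h.cop_Dp, h.cop_DQ, h.cop_pQ, h.three_le_p₁, h.three_le_Q, h.Q_mod,
    hb0, hbt, hv, h.bstar_head, h.bstar_tail, h.vstar_head⟩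

/-- A statistic `F` of the Step-8 outcome `w ∈ ℤ_Mⁿ⁺¹` (valued in any type: a residue, a bit, a tuple…) is
NON-DEMOLITION on the class if on every admissible instance it is almost surely constant on `|φ7.d⟩` — exactly
what Lemma 3.13 needs of its fifth operation to return `|φ8⟩ = |φ7⟩` ("this measurement does not collapse the
state", p. 34).  Chen's `w ↦ w₀ mod Dp₁` is one (`chenStatistic_nonDemolition`).
[cite: ChenQuantumLattice2024, Lemma 3.13 pp. 32–34] -/
def NonDemolition {α : Type*} (F : (Fin (S.n + 1) → ZMod S.M) → α) : Prop :=
  ∀ b₂ v₂ : Fin (S.n + 1) → ℤ, (S.inst b₂ v₂).Admissible →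
    ∀ w w' : Fin (S.n + 1) → ZMod S.M, (S.inst b₂ v₂).phi7d w ≠ 0 → (S.inst b₂ v₂).phi7d w' ≠ 0 → F w = F w'

/-- Chen's read-out `w₀ mod Dp₁` is non-demolition (by Claim 3.14 on every admissible instance); its sure value
`v′₀/D mod Dp₁` is `step8Output` up to the factor `D`. [cite: ChenQuantumLattice2024, Lemma 3.13 p. 32, Claim 3.14 p. 33] -/
theorem chenStatistic_nonDemolition :
    S.NonDemolition (fun w => (((w 0).val : ℤ) : ZMod ((S.D : ℕ) * S.p₁))) := by
  intro b₂ v₂ h₂ w w' hw hw'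
  have e1 := ((S.inst b₂ v₂).claim314_phi7d h₂ w hw).2.2
  have e2 := ((S.inst b₂ v₂).claim314_phi7d h₂ w' hw').2.2
  exact e1.trans e2.symm

/-- The points `(x, 0, …, 0)` with `x ≡ v′₀/D (mod DP)` are in the support of `|φ7.d⟩`.
[cite: ChenQuantumLattice2024, Claim 3.14 p. 33] -/
theorem pred8_cons (h : S.Admissible) (x : ℤ) (hx : (S.D : ℤ) * S.P ∣ x - S.omega) :
    S.pred8 (Fin.cons (((x : ℤ)) : ZMod S.M) (fun _ => 0) : Fin (S.n + 1) → ZMod S.M) := by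
  refine ⟨fun i hi => ?_, ?_⟩
  · obtain ⟨t, rfl⟩ := Fin.exists_succ_eq.2 hi
    simp
  · unfold tInt
    rw [Fin.sum_univ_succ, h.b_head]
    simp only [Fin.cons_zero, Fin.cons_succ, ZMod.val_zero, Nat.cast_zero, mul_zero,
      Finset.sum_const_zero, add_zero]
    have h0 : (((((x : ℤ)) : ZMod S.M)).val : ℤ) = x % (S.M : ℕ) := ZMod.val_intCast _
    rw [h0]
    have hdiv := Int.mul_ediv_add_emod x (S.M : ℕ)
    have hM := S.M_coe
    obtain ⟨c, hc⟩ := hx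
    unfold omega at *
    exact ⟨-c + 2 * S.D * (x / (S.M : ℕ)),
      by linear_combination (-1 : ℤ) * hdiv + (x / (S.M : ℕ)) * hM - hc⟩

/-- **Shift invariance of the sure value.**  For a non-demolition `F`, an admissible instance with `ω = v′₀/D`, and
integers `a, c`: `F(ω, 0, …, 0) = F(ω + 2Dp₁a + DPc, 0, …, 0)` — via the instance with `b_{t₀+1} ↦ b_{t₀+1} − 2p₁a`,
`v′₀ ↦ v′₀ + 2D²p₁a` (still admissible), which shares the witness outcome `(ω + D b_{t₀+1}, 0, …, D, …, 0)` with the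
given one, and whose support contains both `(ω′, 0, …)` and `(ω′ + DPc, 0, …)`.  Needs `n ≥ 1`.
[cite: ChenQuantumLattice2024, Lemma 3.13 pp. 32–34, eq. (12) p. 17, eq. (35) p. 31] -/
theorem nonDemolition_shift (h : S.Admissible) {α : Type*} {F : (Fin (S.n + 1) → ZMod S.M) → α}
    (hF : S.NonDemolition F) (t₀ : Fin S.n) {b₂ v₂ : Fin (S.n + 1) → ℤ} (h₂ : (S.inst b₂ v₂).Admissible)
    (a c : ℤ) :
    F (Fin.cons ((((S.inst b₂ v₂).omega : ℤ)) : ZMod S.M) (fun _ => 0))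
      = F (Fin.cons ((((S.inst b₂ v₂).omega + 2 * S.D * S.p₁ * a + S.D * S.P * c : ℤ)) : ZMod S.M)
          (fun _ => 0)) := by
  have hD0 : (S.D : ℤ) ≠ 0 := by exact_mod_cast S.D.ne_zero
  -- the auxiliary instance
  obtain ⟨b₄, hb₄⟩ : ∃ b₄ : Fin (S.n + 1) → ℤ, b₄ = Function.update b₂ t₀.succ (b₂ t₀.succ - 2 * S.p₁ * a) :=
    ⟨_, rfl⟩
  obtain ⟨v₄, hv₄⟩ : ∃ v₄ : Fin (S.n + 1) → ℤ, v₄ = Function.update v₂ 0 (v₂ 0 + S.D * (2 * S.D * S.p₁ * a)) :=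
    ⟨_, rfl⟩
  have h₄ : (S.inst b₄ v₄).Admissible := by
    refine S.inst_admissible h ?_ (fun i hi => ?_) (fun i => ?_)
    · rw [hb₄, Function.update_of_ne (Fin.succ_ne_zero t₀).symm]
      exact h₂.b_head
    · rw [hb₄]
      by_cases hit : i = t₀.succ
      · subst hit
        rw [Function.update_self]
        exact dvd_sub (h₂.b_tail _ hi) ⟨a, by ring⟩
      · rw [Function.update_of_ne hit]
        exact h₂.b_tail i hi
    · rw [hv₄]
      by_cases hi0 : i = 0
      · subst hi0
        rw [Function.update_self]
        exact dvd_add (h₂.v'_in_DZ 0) (dvd_mul_right _ _)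
      · rw [Function.update_of_ne hi0]
        exact h₂.v'_in_DZ i
  have hω₄ : (S.inst b₄ v₄).omega = (S.inst b₂ v₂).omega + 2 * S.D * S.p₁ * a := by
    show v₄ 0 / (S.D : ℤ) = v₂ 0 / (S.D : ℤ) + _
    rw [hv₄, Function.update_self, Int.add_mul_ediv_left _ _ hD0]
  have hb₄t : b₄ t₀.succ = b₂ t₀.succ - 2 * S.p₁ * a := by rw [hb₄, Function.update_self]
  -- the two instances share the witness outcome
  have hW : (S.inst b₄ v₄).wit t₀ = (S.inst b₂ v₂).wit t₀ := by
    unfold wit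
    congr 2
    rw [hω₄]
    show (S.inst b₂ v₂).omega + 2 * S.D * S.p₁ * a + (S.D : ℤ) * b₄ t₀.succ
      = (S.inst b₂ v₂).omega + (S.D : ℤ) * b₂ t₀.succ
    rw [hb₄t]
    ring
  have sup₂ : ∀ x : ℤ, (S.D : ℤ) * S.P ∣ x - (S.inst b₂ v₂).omega →
      (S.inst b₂ v₂).phi7d (Fin.cons (((x : ℤ)) : ZMod S.M) (fun _ => 0)) ≠ 0 :=
    fun x hx => ((S.inst b₂ v₂).phi7d_ne_zero_iff h₂ _).2 ((S.inst b₂ v₂).pred8_cons h₂ x hx)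
  have sup₄ : ∀ x : ℤ, (S.D : ℤ) * S.P ∣ x - (S.inst b₄ v₄).omega →
      (S.inst b₄ v₄).phi7d (Fin.cons (((x : ℤ)) : ZMod S.M) (fun _ => 0)) ≠ 0 :=
    fun x hx => ((S.inst b₄ v₄).phi7d_ne_zero_iff h₄ _).2 ((S.inst b₄ v₄).pred8_cons h₄ x hx)
  have wit₂ := ((S.inst b₂ v₂).phi7d_ne_zero_iff h₂ _).2 ((S.inst b₂ v₂).pred8_wit h₂ t₀)
  have wit₄ := ((S.inst b₄ v₄).phi7d_ne_zero_iff h₄ _).2 ((S.inst b₄ v₄).pred8_wit h₄ t₀)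
  rw [hW] at wit₄
  have stepA : F (Fin.cons ((((S.inst b₂ v₂).omega : ℤ)) : ZMod S.M) (fun _ => 0))
      = F (Fin.cons ((((S.inst b₂ v₂).omega + 2 * S.D * S.p₁ * a : ℤ)) : ZMod S.M) (fun _ => 0)) := by
    have e1 := hF b₂ v₂ h₂ _ _ (sup₂ (S.inst b₂ v₂).omega (by simp)) wit₂
    have e2 := hF b₄ v₄ h₄ _ _ wit₄ (sup₄ ((S.inst b₂ v₂).omega + 2 * S.D * S.p₁ * a) (by rw [hω₄]; simp))
    exact e1.trans e2
  have stepB : F (Fin.cons ((((S.inst b₂ v₂).omega + 2 * S.D * S.p₁ * a : ℤ)) : ZMod S.M) (fun _ => 0))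
      = F (Fin.cons ((((S.inst b₂ v₂).omega + 2 * S.D * S.p₁ * a + S.D * S.P * c : ℤ)) : ZMod S.M)
          (fun _ => 0)) :=
    hF b₄ v₄ h₄ _ _ (sup₄ _ (by rw [hω₄]; simp)) (sup₄ _ (by rw [hω₄]; exact ⟨c, by ring⟩))
  exact stepA.trans stepB

/-- **THE INFORMATION CEILING OF STEP 8.**  Let `n ≥ 1` and let `F` be ANY statistic of the Step-8 outcome `w`
(a function of the computational-basis outcome; general instruments are not modelled) that is non-demolition on
the class of admissible instances with the public parameters `n, D, p₁, Q`.  Then its (sure) value on an instance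
depends on the unknown `v′` only through `v′₀ mod D²p₁ = step8Output`: two admissible instances `(b, v′)`,
`(b′, v″)` with `v′₀ ≡ v″₀ (mod D²p₁)` give the same value.  (Chen's read-out attains this:
`chenStatistic_nonDemolition`.)  So no fifth operation that computes and measures a function of `w` — Chen's
computes `w₀ mod Dp₁` — makes Step 8 deliver `v′₀ mod D²P`.
[cite: ChenQuantumLattice2024, Lemma 3.13 pp. 32–34; this bundle, `REPAIR-CENSUS.md` T7] -/
theorem step8_information_ceiling (h : S.Admissible) (hn : 0 < S.n) {α : Type*}
    {F : (Fin (S.n + 1) → ZMod S.M) → α} (hF : S.NonDemolition F)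
    {b₂ v₂ b₃ v₃ : Fin (S.n + 1) → ℤ} (h₂ : (S.inst b₂ v₂).Admissible) (h₃ : (S.inst b₃ v₃).Admissible)
    (hv : ((v₂ 0 : ℤ) : ZMod ((S.D : ℕ) ^ 2 * S.p₁)) = ((v₃ 0 : ℤ) : ZMod ((S.D : ℕ) ^ 2 * S.p₁)))
    {w w' : Fin (S.n + 1) → ZMod S.M} (hw : (S.inst b₂ v₂).phi7d w ≠ 0)
    (hw' : (S.inst b₃ v₃).phi7d w' ≠ 0) : F w = F w' := by
  have hD0 : (S.D : ℤ) ≠ 0 := by exact_mod_cast S.D.ne_zero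
  obtain ⟨ω₂, hω₂⟩ := h₂.v'_in_DZ 0
  obtain ⟨ω₃, hω₃⟩ := h₃.v'_in_DZ 0
  have e2 : (S.inst b₂ v₂).omega = ω₂ := by
    show v₂ 0 / (S.D : ℤ) = ω₂
    rw [show v₂ 0 = S.D * ω₂ from hω₂, Int.mul_ediv_cancel_left _ hD0]
  have e3 : (S.inst b₃ v₃).omega = ω₃ := by
    show v₃ 0 / (S.D : ℤ) = ω₃
    rw [show v₃ 0 = S.D * ω₃ from hω₃, Int.mul_ediv_cancel_left _ hD0]
  -- `Dp₁ ∣ ω₃ − ω₂`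
  have h1 : (((S.D : ℕ) ^ 2 * S.p₁ : ℕ) : ℤ) ∣ v₃ 0 - v₂ 0 := (ZMod.intCast_eq_intCast_iff_dvd_sub _ _ _).1 hv
  have h2 : (S.D : ℤ) * ((S.D : ℤ) * S.p₁) ∣ (S.D : ℤ) * (ω₃ - ω₂) := by
    have e : (S.D : ℤ) * (ω₃ - ω₂) = v₃ 0 - v₂ 0 := by
      rw [show v₂ 0 = S.D * ω₂ from hω₂, show v₃ 0 = S.D * ω₃ from hω₃]
      ring
    have e' : (S.D : ℤ) * ((S.D : ℤ) * S.p₁) = (((S.D : ℕ) ^ 2 * S.p₁ : ℕ) : ℤ) := by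
      push_cast
      ring
    rw [e, e']
    exact h1
  obtain ⟨m, hm⟩ := (mul_dvd_mul_iff_left hD0).1 h2
  -- `Q` odd: `Dp₁ = DP − 2Dp₁·((Q−1)/2)`
  obtain ⟨r, hr⟩ := h.odd_Q
  have hω : ω₃ = ω₂ + 2 * S.D * S.p₁ * (-(r : ℤ) * m) + S.D * S.P * m := by
    have hP : ((S.P : ℕ) : ℤ) = S.p₁ * S.Q := by
      show (((S.p₁ * S.Q : ℕ+) : ℕ) : ℤ) = _
      push_cast
      ring
    have hQ : ((S.Q : ℕ) : ℤ) = 2 * r + 1 := by exact_mod_cast hr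
    rw [hP, hQ]
    linear_combination hm
  have vw : F w = F (Fin.cons ((((S.inst b₂ v₂).omega : ℤ)) : ZMod S.M) (fun _ => 0)) :=
    hF b₂ v₂ h₂ _ _ hw (((S.inst b₂ v₂).phi7d_ne_zero_iff h₂ _).2 ((S.inst b₂ v₂).pred8_cons h₂ _ (by simp)))
  have vw' : F w' = F (Fin.cons ((((S.inst b₃ v₃).omega : ℤ)) : ZMod S.M) (fun _ => 0)) :=
    hF b₃ v₃ h₃ _ _ hw' (((S.inst b₃ v₃).phi7d_ne_zero_iff h₃ _).2 ((S.inst b₃ v₃).pred8_cons h₃ _ (by simp)))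
  rw [vw, vw', S.nonDemolition_shift h hF ⟨0, hn⟩ h₂ (-(r : ℤ) * m) m, e2, e3, hω]

/-- **Corollary (the link T7 → O1 of the autopsy):** for `n ≥ 1` and any non-demolition read-out `F`, there is an
admissible instance with the SAME `b` and the same `step8Output` but a DIFFERENT `step9Needs = v′₀ mod D²P`, on
which `F` takes the same sure value as on `S`: Step 8 cannot supply what Step 9 consumes.
[cite: ChenQuantumLattice2024, Lemma 3.13 p. 32, §3.5.9 p. 37; this bundle, `STEPS.md` §4.3] -/
theorem step8_cannot_supply_step9Needs (h : S.Admissible) (hn : 0 < S.n) {α : Type*}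
    {F : (Fin (S.n + 1) → ZMod S.M) → α} (hF : S.NonDemolition F) :
    ∃ v₃ : Fin (S.n + 1) → ℤ, (S.inst S.b v₃).Admissible
      ∧ (S.inst S.b v₃).step8Output = S.step8Output
      ∧ (S.inst S.b v₃).step9Needs ≠ S.step9Needs
      ∧ ∀ w w' : Fin (S.n + 1) → ZMod S.M, S.phi7d w ≠ 0 → (S.inst S.b v₃).phi7d w' ≠ 0 → F w = F w' := by
  obtain ⟨v₃, hv₃⟩ : ∃ v₃ : Fin (S.n + 1) → ℤ, v₃ = Function.update S.v' 0 (S.v' 0 + (S.D : ℤ) ^ 2 * S.p₁) :=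
    ⟨_, rfl⟩
  have hv₃0 : v₃ 0 = S.v' 0 + (S.D : ℤ) ^ 2 * S.p₁ := by rw [hv₃, Function.update_self]
  have h₃ : (S.inst S.b v₃).Admissible := by
    refine S.inst_admissible h h.b_head h.b_tail fun i => ?_
    by_cases hi : i = 0
    · subst hi
      rw [hv₃0]
      exact dvd_add (h.v'_in_DZ 0) ⟨S.D * S.p₁, by ring⟩
    · rw [hv₃, Function.update_of_ne hi]
      exact h.v'_in_DZ i
  have h8 : ((v₃ 0 : ℤ) : ZMod ((S.D : ℕ) ^ 2 * S.p₁)) = ((S.v' 0 : ℤ) : ZMod ((S.D : ℕ) ^ 2 * S.p₁)) := by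
    rw [hv₃0, ZMod.intCast_eq_intCast_iff_dvd_sub]
    exact ⟨-1, by push_cast; ring⟩
  have h9 : ((v₃ 0 : ℤ) : ZMod S.N) ≠ ((S.v' 0 : ℤ) : ZMod S.N) := by
    rw [hv₃0, Ne, ZMod.intCast_eq_intCast_iff_dvd_sub]
    intro hdvd
    have hN : ((S.N : ℕ) : ℤ) = (S.D : ℤ) ^ 2 * S.p₁ * S.Q := by
      show ((((S.D * S.D * (S.p₁ * S.Q)) : ℕ+) : ℕ) : ℤ) = _
      push_cast
      ring
    rw [hN, show S.v' 0 - (S.v' 0 + (S.D : ℤ) ^ 2 * S.p₁) = -((S.D : ℤ) ^ 2 * S.p₁) by ring, dvd_neg] at hdvd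
    have hD : (0 : ℤ) < S.D := by exact_mod_cast S.D.pos
    have hp : (0 : ℤ) < S.p₁ := by exact_mod_cast S.p₁.pos
    have hpos : (0 : ℤ) < (S.D : ℤ) ^ 2 * S.p₁ := by positivity
    have hle := Int.le_of_dvd hpos hdvd
    have hQ3 : (3 : ℤ) ≤ S.Q := by exact_mod_cast h.three_le_Q
    nlinarith
  have hS : (S.inst S.b S.v').Admissible := h
  refine ⟨v₃, h₃, h8, h9, fun w w' hw hw' => ?_⟩
  exact S.step8_information_ceiling h hn hF hS h₃ h8.symm hw hw'

end Shape

end Literature.Computability.Cryptography.Chen2024
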